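import Mathlib
import HarnessLib

/-!
# Bierstone–Milman: the order pair `(d, Ω)` of a toric hypersurface drops under blowing up a
# component of the maximum-order locus

Source: E. Bierstone, P. D. Milman, *Desingularization of toric and binomial varieties*,
J. Algebraic Geom. **15** (2006) 443–486 (arXiv:math/0411340), §5.1, Theorem 5.3, Algorithm 5.5
(bib key `BierstoneMilman2006`).

An affine toric hypersurface is `X = V(x^A − x^B) ⊂ 𝔸ⁿ` with exponent vectors `A, B : Fin n → ℕ` of
disjoint supports (BM write `x^{γ⁺} − x^{γ⁻}`).  Its maximum order is `d = min(|A|, |B|)` (taken at the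
origin) and BM set `Ω = max(|A|, |B|)`.  For a face `Δ ⊆ {1,…,n}` put `d_Δ = min(A_Δ, B_Δ)` (partial
sums over `Δ`).  The coordinate subspace `Z_Δ = V(x_i : i ∈ Δ)` lies in the maximum-order locus iff
`d_Δ = d` (*admissible*), and is an irreducible COMPONENT of it iff moreover `d_{Δ'} < d` for every
proper subface (*minimal*), BM §5.1 (5.1)–(5.3).  Blowing up `Z_Δ`, in the chart `x_j` (`j ∈ Δ`) the
substitution `x_i ↦ x_j x_i (i ∈ Δ, i ≠ j)` replaces the exponent of `x_j` by `A_Δ` resp. `B_Δ`, and the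
strict transform cancels the common factor `x_j^{d_Δ}`.  BM's «main point» (§5.1, last display):

  `(d_σ, Ω_σ) < (d_Σ, Ω_Σ)` lexicographically, for every cone `σ` of the star-subdivision,

i.e. in every chart of the blow-up of a minimal admissible `Z_Δ` the pair `(d, Ω)` of the strict
transform is lexicographically smaller.  Iterating (Algorithm 5.5: «any minimal star-subdivision»)
therefore terminates (Theorem 5.3, `d = 0`), which is BM's Theorem 1.4: a toric hypersurface over ANY
field is resolved by blowing up, at each step, ANY irreducible component of its maximum-order locus.

This file proves the affine-chart form of the §5.1 inequality as pure exponent combinatorics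
(`ToricHypBM.pair_chart_lt`) and the resulting impossibility of an infinite run
(`ToricHypBM.no_infinite_run`), plus the `decide` instances used on the D-0124 bed
(`x³ − yzw`, `x⁴ − yzwt`).  Deliberately NOT here: fans, the scheme `X`, normal flatness, the
identification «maximum-order locus = ⋃ minimal Z_Δ» (BM Cor. 3.5 / Prop. 5.2) — we only vendor the
combinatorial decrease law and cite the geometric dictionary.
-/

namespace Literature.AlgebraicGeometry.Resolution

open Finset

-- Exponent bookkeeping for Bierstone–Milman's toric hypersurfaces `x^A − x^B` (BM 2006 §5.1).
namespace ToricHypBM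

variable {n : ℕ}

/-- Total degree `|A| = ∑ᵢ Aᵢ` of an exponent vector. [cite: BierstoneMilman2006, §5.1] -/
def tot (A : Fin n → ℕ) : ℕ := ∑ i, A i

/-- Partial sum `A_Δ = ∑_{i ∈ Δ} Aᵢ` over a face `Δ`. [cite: BierstoneMilman2006, §5.1] -/
def fsum (A : Fin n → ℕ) (Δ : Finset (Fin n)) : ℕ := ∑ i ∈ Δ, A i

/-- `d_Δ := min(A_Δ, B_Δ)` (BM write `min{γ⁻_Δ, γ⁺_Δ}`). [cite: BierstoneMilman2006, §5.1] -/
def dFace (A B : Fin n → ℕ) (Δ : Finset (Fin n)) : ℕ := min (fsum A Δ) (fsum B Δ)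

/-- The maximum order `d = min(|A|, |B|)` of `x^A − x^B` (attained at the origin).
[cite: BierstoneMilman2006, §5.1] -/
def ord (A B : Fin n → ℕ) : ℕ := min (tot A) (tot B)

/-- `Ω = max(|A|, |B|)`. [cite: BierstoneMilman2006, §5.1] -/
def omega (A B : Fin n → ℕ) : ℕ := max (tot A) (tot B)

/-- The pair `(d, Ω)` in the lexicographic order. [cite: BierstoneMilman2006, §5.1] -/
def pair (A B : Fin n → ℕ) : Lex (ℕ × ℕ) := toLex (ord A B, omega A B)

/-- `Z_Δ` lies in the maximum-order locus: `d_Δ = d` (BM (5.1), «admissible»).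
[cite: BierstoneMilman2006, §5.1 (5.1) / Definitions 5.1] -/
def Admissible (A B : Fin n → ℕ) (Δ : Finset (Fin n)) : Prop := dFace A B Δ = ord A B

/-- `Z_Δ` is an irreducible COMPONENT of the maximum-order locus: admissible and every proper subface
has `d_{Δ'} < d` (BM (5.3), «minimal»). [cite: BierstoneMilman2006, §5.1 (5.3) / Definitions 5.1] -/
def MinimalAdmissible (A B : Fin n → ℕ) (Δ : Finset (Fin n)) : Prop :=
  Admissible A B Δ ∧ ∀ Δ' ∈ Δ.ssubsets, dFace A B Δ' < ord A B

/-- `MinimalAdmissible` with the strict-subface quantifier spelled as `Δ' ⊂ Δ`.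
[cite: BierstoneMilman2006, §5.1 (5.3)] -/
theorem minimalAdmissible_iff {A B : Fin n → ℕ} {Δ : Finset (Fin n)} :
    MinimalAdmissible A B Δ ↔ (Admissible A B Δ ∧ ∀ Δ' ⊂ Δ, dFace A B Δ' < ord A B) := by
  simp only [MinimalAdmissible, Finset.mem_ssubsets]

/-- Exponent vector `A` of the strict transform in the chart `x_j` of the blow-up with centre `Z_Δ`:
the exponent of `x_j` becomes `A_Δ − d_Δ` (the subtraction is never truncated: `d_Δ ≤ A_Δ`).
[cite: BierstoneMilman2006, §4.1 / §5.1] -/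
def chartA (A B : Fin n → ℕ) (Δ : Finset (Fin n)) (j : Fin n) : Fin n → ℕ :=
  Function.update A j (fsum A Δ - dFace A B Δ)

/-- Exponent vector `B` of the strict transform in the chart `x_j` (see `chartA`).
[cite: BierstoneMilman2006, §4.1 / §5.1] -/
def chartB (A B : Fin n → ℕ) (Δ : Finset (Fin n)) (j : Fin n) : Fin n → ℕ :=
  Function.update B j (fsum B Δ - dFace A B Δ)

/-! ### Symmetry `A ↔ B` -/

/-- [cite: BierstoneMilman2006, §5.1] -/
theorem dFace_comm (A B : Fin n → ℕ) (Δ : Finset (Fin n)) : dFace A B Δ = dFace B A Δ :=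
  min_comm _ _

/-- [cite: BierstoneMilman2006, §5.1] -/
theorem ord_comm (A B : Fin n → ℕ) : ord A B = ord B A := min_comm _ _

/-- [cite: BierstoneMilman2006, §5.1] -/
theorem omega_comm (A B : Fin n → ℕ) : omega A B = omega B A := max_comm _ _

/-- [cite: BierstoneMilman2006, §5.1] -/
theorem pair_comm (A B : Fin n → ℕ) : pair A B = pair B A := by
  simp [pair, ord_comm A B, omega_comm A B]

/-- [cite: BierstoneMilman2006, §5.1] -/
theorem minimalAdmissible_comm {A B : Fin n → ℕ} {Δ : Finset (Fin n)} :
    MinimalAdmissible A B Δ ↔ MinimalAdmissible B A Δ := by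
  simp [MinimalAdmissible, Admissible, dFace_comm A B, ord_comm A B]

/-- [cite: BierstoneMilman2006, §5.1] -/
theorem chartA_comm (A B : Fin n → ℕ) (Δ : Finset (Fin n)) (j : Fin n) :
    chartA A B Δ j = chartB B A Δ j := by
  simp [chartA, chartB, dFace_comm A B]

/-- [cite: BierstoneMilman2006, §5.1] -/
theorem chartB_comm (A B : Fin n → ℕ) (Δ : Finset (Fin n)) (j : Fin n) :
    chartB A B Δ j = chartA B A Δ j := by
  simp [chartA, chartB, dFace_comm A B]

/-! ### Elementary sums -/

/-- `A_Δ ≤ |A|`. [folklore] -/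
private theorem fsum_le_tot (A : Fin n → ℕ) (Δ : Finset (Fin n)) : fsum A Δ ≤ tot A :=
  Finset.sum_le_sum_of_subset (Finset.subset_univ Δ)

/-- `A_{Δ ∖ j} + A_j = A_Δ` for `j ∈ Δ`. [folklore] -/
private theorem fsum_erase_add (A : Fin n → ℕ) {Δ : Finset (Fin n)} {j : Fin n} (hj : j ∈ Δ) :
    fsum A (Δ.erase j) + A j = fsum A Δ :=
  Finset.sum_erase_add Δ A hj

/-- Total degree after updating one exponent. [folklore] -/
private theorem tot_update (A : Fin n → ℕ) (j : Fin n) (v : ℕ) :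
    tot (Function.update A j v) + A j = tot A + v := by
  unfold tot
  rw [Finset.sum_update_of_mem (Finset.mem_univ j), Finset.sdiff_singleton_eq_erase]
  have h := Finset.sum_erase_add Finset.univ A (Finset.mem_univ j)
  omega

/-! ### The decrease law -/

/-- Core case `|B| ≤ |A|` of `pair_chart_lt`. [cite: BierstoneMilman2006, §5.1 (last display)] -/
theorem pair_chart_lt_of_le {A B : Fin n → ℕ} {Δ : Finset (Fin n)} {j : Fin n}
    (hAB : ∀ i, A i = 0 ∨ B i = 0) (hle : tot B ≤ tot A)
    (hΔ : MinimalAdmissible A B Δ) (hj : j ∈ Δ) :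
    pair (chartA A B Δ j) (chartB A B Δ j) < pair A B := by
  obtain ⟨hadm, hmin⟩ := minimalAdmissible_iff.mp hΔ
  have hord : ord A B = tot B := by unfold ord; exact min_eq_right hle
  have homega : omega A B = tot A := by unfold omega; exact max_eq_left hle
  have hBΔle : fsum B Δ ≤ tot B := fsum_le_tot B Δ
  -- admissibility forces `B_Δ = |B|` and `A_Δ ≥ |B|`
  have hdF : dFace A B Δ = tot B := by rw [← hord]; exact hadm
  have hBΔ : fsum B Δ = tot B := by
    apply le_antisymm hBΔle
    have : dFace A B Δ ≤ fsum B Δ := min_le_right _ _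
    omega
  have hAΔ : tot B ≤ fsum A Δ := by
    have : dFace A B Δ ≤ fsum A Δ := min_le_left _ _
    by_contra h
    have h' : fsum A Δ < tot B := lt_of_not_ge h
    have : dFace A B Δ = fsum A Δ := by unfold dFace; exact min_eq_left (by omega)
    omega
  -- the proper subface `Δ ∖ {j}`
  have hsub : Δ.erase j ⊂ Δ := Finset.erase_ssubset hj
  have hmin' := hmin _ hsub
  have hA' := fsum_erase_add A hj
  have hB' := fsum_erase_add B hj
  -- `j` lies in one of the two supports
  have hj0 : ¬ (A j = 0 ∧ B j = 0) := by
    rintro ⟨hA0, hB0⟩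
    have h1 : fsum A (Δ.erase j) = fsum A Δ := by omega
    have h2 : fsum B (Δ.erase j) = fsum B Δ := by omega
    have : dFace A B (Δ.erase j) = dFace A B Δ := by unfold dFace; rw [h1, h2]
    rw [this, hdF, hord] at hmin'
    exact lt_irrefl _ hmin'
  -- totals of the transformed vectors
  have htA : tot (chartA A B Δ j) + A j = tot A + (fsum A Δ - tot B) := by
    have := tot_update A j (fsum A Δ - dFace A B Δ)
    rw [hdF] at this
    simpa only [chartA, hdF] using this
  have htB : tot (chartB A B Δ j) + B j = tot B := by
    have := tot_update B j (fsum B Δ - dFace A B Δ)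
    rw [hdF, hBΔ, Nat.sub_self, add_zero] at this
    simpa only [chartB, hdF, hBΔ, Nat.sub_self] using this
  rw [pair, pair, hord, homega, Prod.Lex.toLex_lt_toLex]
  rcases hAB j with hA0 | hB0
  · -- `A j = 0`, hence `B j ≥ 1`: the order drops
    have hBj : 0 < B j := by
      rcases Nat.eq_zero_or_pos (B j) with h | h
      · exact absurd ⟨hA0, h⟩ hj0
      · exact h
    left
    calc ord (chartA A B Δ j) (chartB A B Δ j) ≤ tot (chartB A B Δ j) := min_le_right _ _
      _ < tot B := by omega
  · -- `B j = 0`, hence `A j ≥ 1`: `|B|` is kept and `|A|` drops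
    have hAj : 0 < A j := by
      rcases Nat.eq_zero_or_pos (A j) with h | h
      · exact absurd ⟨h, hB0⟩ hj0
      · exact h
    have htB' : tot (chartB A B Δ j) = tot B := by rw [hB0, add_zero] at htB; exact htB
    -- minimality at `Δ ∖ {j}`: `A_Δ − A_j < |B|`
    have hlt : fsum A Δ < tot B + A j := by
      by_contra h
      have h' : tot B + A j ≤ fsum A Δ := le_of_not_gt h
      have h1 : fsum B (Δ.erase j) = tot B := by omega
      have h2 : tot B ≤ fsum A (Δ.erase j) := by omega
      have : dFace A B (Δ.erase j) = tot B := by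
        unfold dFace; rw [h1]; exact min_eq_right h2
      rw [this, hord] at hmin'
      exact lt_irrefl _ hmin'
    have htA' : tot (chartA A B Δ j) < tot A := by omega
    by_cases hc : tot (chartA A B Δ j) < tot B
    · left
      calc ord (chartA A B Δ j) (chartB A B Δ j) ≤ tot (chartA A B Δ j) := min_le_left _ _
        _ < tot B := hc
    · right
      have hc' : tot B ≤ tot (chartA A B Δ j) := le_of_not_gt hc
      refine ⟨?_, ?_⟩
      · unfold ord; rw [htB']; exact min_eq_right hc'
      · unfold omega; rw [htB', max_eq_left hc']; exact htA'

/-- **Bierstone–Milman §5.1 (affine-chart form).**  For a toric hypersurface `x^A − x^B` (disjoint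
supports) and a minimal admissible face `Δ` containing `j` (an irreducible component `Z_Δ` of the
maximum-order locus; a nonempty minimal admissible face forces positive order), in EVERY chart `x_j`
of the blow-up with centre `Z_Δ` the pair `(d, Ω)` of the strict transform is lexicographically
smaller: «`(d_σ, Ω_σ) < (d_Σ, Ω_Σ)` … for every cone `σ ∈ Σ'`».
[cite: BierstoneMilman2006, §5.1 (last display) / Thm 5.3] -/
theorem pair_chart_lt {A B : Fin n → ℕ} {Δ : Finset (Fin n)} {j : Fin n}
    (hAB : ∀ i, A i = 0 ∨ B i = 0)
    (hΔ : MinimalAdmissible A B Δ) (hj : j ∈ Δ) :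
    pair (chartA A B Δ j) (chartB A B Δ j) < pair A B := by
  rcases le_total (tot B) (tot A) with hle | hle
  · exact pair_chart_lt_of_le hAB hle hΔ hj
  · have hBA : ∀ i, B i = 0 ∨ A i = 0 := fun i => (hAB i).symm
    have h := pair_chart_lt_of_le hBA hle (minimalAdmissible_comm.mp hΔ) hj
    rwa [← chartB_comm A B, ← chartA_comm A B, pair_comm (chartB A B Δ j), pair_comm B A] at h

/-- A *BM run*: a sequence of exponent pairs in which every step is some chart of the blow-up of some
irreducible component of the maximum-order locus (Algorithm 5.5: «any minimal star-subdivision»),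
performed while the order is positive. [cite: BierstoneMilman2006, Algorithm 5.5] -/
def IsRun (S : ℕ → (Fin n → ℕ) × (Fin n → ℕ)) : Prop :=
  ∀ k, (∀ i, (S k).1 i = 0 ∨ (S k).2 i = 0) ∧ 0 < ord (S k).1 (S k).2 ∧
    ∃ Δ j, MinimalAdmissible (S k).1 (S k).2 Δ ∧ j ∈ Δ ∧
      (S (k + 1)).1 = chartA (S k).1 (S k).2 Δ j ∧ (S (k + 1)).2 = chartB (S k).1 (S k).2 Δ j

/-- **Termination (Bierstone–Milman Theorem 5.3 / Theorem 1.4, combinatorial core).**  There is no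
infinite BM run: along any branch of charts the order `d` of the toric hypersurface reaches `0` after
finitely many blow-ups of maximum-order components, whichever components are chosen.
[cite: BierstoneMilman2006, Thm 5.3 / Thm 1.4] -/
theorem no_infinite_run (S : ℕ → (Fin n → ℕ) × (Fin n → ℕ)) (hS : IsRun S) : False := by
  have hdec : ∀ k, pair (S (k + 1)).1 (S (k + 1)).2 < pair (S k).1 (S k).2 := by
    intro k
    obtain ⟨hAB, _hd, Δ, j, hΔ, hj, h1, h2⟩ := hS k
    rw [h1, h2]
    exact pair_chart_lt hAB hΔ hj
  have hwf : WellFounded ((· < ·) : Lex (ℕ × ℕ) → Lex (ℕ × ℕ) → Prop) := wellFounded_lt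
  exact (wellFounded_iff_isEmpty_descending_chain.mp hwf).false ⟨fun k => pair (S k).1 (S k).2, hdec⟩

/-! ### Bed instances (D-0124): `x³ − yzw` and `x⁴ − yzwt` -/

/-- `x³ − yzw ⊂ 𝔸⁴`: `(d, Ω) = (3, 3)`; the origin `Z_univ` is the unique maximum-order component;
in the `y`-chart the strict transform is `x³ − zw` with `(d, Ω) = (2, 3)`; blowing up its
maximum-order component, the LINE `V(x, z, w)`, gives `(1, 2)` in the `x`-chart — while blowing up
the POINT `V(x, y, z, w)` instead gives `(2, 4)` in the `y`-chart (an admissible, NON-minimal centre: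
BM's law does not apply and the pair rises).  Numerical cells of the D-0124 bed row `bed:x3yzw:3`.
[cite: BierstoneMilman2006, §5.1] -/
theorem x3yzw_cells :
    ord ![3, 0, 0, 0] ![0, 1, 1, 1] = 3 ∧ omega ![3, 0, 0, 0] ![0, 1, 1, 1] = 3 ∧
    MinimalAdmissible ![3, 0, 0, 0] ![0, 1, 1, 1] Finset.univ ∧
    chartA ![3, 0, 0, 0] ![0, 1, 1, 1] Finset.univ 1 = ![3, 0, 0, 0] ∧
    chartB ![3, 0, 0, 0] ![0, 1, 1, 1] Finset.univ 1 = ![0, 0, 1, 1] ∧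
    ord ![3, 0, 0, 0] ![0, 0, 1, 1] = 2 ∧ omega ![3, 0, 0, 0] ![0, 0, 1, 1] = 3 ∧
    MinimalAdmissible ![3, 0, 0, 0] ![0, 0, 1, 1] {0, 2, 3} ∧
    ord (chartA ![3, 0, 0, 0] ![0, 0, 1, 1] {0, 2, 3} 0)
        (chartB ![3, 0, 0, 0] ![0, 0, 1, 1] {0, 2, 3} 0) = 1 ∧
    omega (chartA ![3, 0, 0, 0] ![0, 0, 1, 1] {0, 2, 3} 0)
        (chartB ![3, 0, 0, 0] ![0, 0, 1, 1] {0, 2, 3} 0) = 2 ∧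
    Admissible ![3, 0, 0, 0] ![0, 0, 1, 1] Finset.univ ∧
    ¬ MinimalAdmissible ![3, 0, 0, 0] ![0, 0, 1, 1] Finset.univ ∧
    ord (chartA ![3, 0, 0, 0] ![0, 0, 1, 1] Finset.univ 1)
        (chartB ![3, 0, 0, 0] ![0, 0, 1, 1] Finset.univ 1) = 2 ∧
    omega (chartA ![3, 0, 0, 0] ![0, 0, 1, 1] Finset.univ 1)
        (chartB ![3, 0, 0, 0] ![0, 0, 1, 1] Finset.univ 1) = 4 := by
  unfold MinimalAdmissible Admissible
  decide

/-- `x⁴ − yzwt ⊂ 𝔸⁵` (TORIC5): `(d, Ω) = (4, 4)`; after the origin blow-up, `y`-chart: `x⁴ − zwt`,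
`(3, 4)`; the maximum-order component there is the LINE `V(x, z, w, t)` (not the origin), and blowing
up the origin instead raises the pair to `(3, 5)` in the `y`-chart.
[cite: BierstoneMilman2006, §5.1] -/
theorem toric5_cells :
    ord ![4, 0, 0, 0, 0] ![0, 1, 1, 1, 1] = 4 ∧ omega ![4, 0, 0, 0, 0] ![0, 1, 1, 1, 1] = 4 ∧
    MinimalAdmissible ![4, 0, 0, 0, 0] ![0, 1, 1, 1, 1] Finset.univ ∧
    ord (chartA ![4, 0, 0, 0, 0] ![0, 1, 1, 1, 1] Finset.univ 1)
        (chartB ![4, 0, 0, 0, 0] ![0, 1, 1, 1, 1] Finset.univ 1) = 3 ∧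
    omega (chartA ![4, 0, 0, 0, 0] ![0, 1, 1, 1, 1] Finset.univ 1)
        (chartB ![4, 0, 0, 0, 0] ![0, 1, 1, 1, 1] Finset.univ 1) = 4 ∧
    MinimalAdmissible ![4, 0, 0, 0, 0] ![0, 0, 1, 1, 1] {0, 2, 3, 4} ∧
    ¬ MinimalAdmissible ![4, 0, 0, 0, 0] ![0, 0, 1, 1, 1] Finset.univ ∧
    ord (chartA ![4, 0, 0, 0, 0] ![0, 0, 1, 1, 1] Finset.univ 1)
        (chartB ![4, 0, 0, 0, 0] ![0, 0, 1, 1, 1] Finset.univ 1) = 3 ∧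
    omega (chartA ![4, 0, 0, 0, 0] ![0, 0, 1, 1, 1] Finset.univ 1)
        (chartB ![4, 0, 0, 0, 0] ![0, 0, 1, 1, 1] Finset.univ 1) = 5 := by
  unfold MinimalAdmissible Admissible
  decide

end ToricHypBM

end Literature.AlgebraicGeometry.Resolution
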